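import Summits.HodgeConjecture.HodgeConjecture.Theses.EndoscopicMiddleDegree

/-!
# Ideator 5 (round 2) sketch for crux `IsotypicMiddleClassesAlgebraic` (stmt-HodgeConjecture-14301)

First lemmas of the two crux idea cards filed by ideator 5:

* `DivisorialInvisibility` / `divisorialInvisibility_holds` (card `noncongruence-divisor-ring`):
  a rational Hodge `(n,n)`-class cup-orthogonal to the Lefschetz summand
  `Hdg^{n-1,n-1}_ℚ · N¹` of the theta world is ANNIHILATED by every divisor class:
  `e ∪ d = 0` in `H^{2n+2}` — PROVED below from four classical inputs taken as hypotheses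
  (Poincaré duality; BMM Cor. 62 "H^{n-1,n-1} is spanned by rational Hodge classes" for `n ≤ 3`
  plus Hodge-type orthogonality; Hodge types add under `∪`; associativity/commutativity of `∪`).
  Consequence: no monomial in divisor classes of ANY congruence level detects the orphan piece, so
  a divisor-based detector must live on a NON-congruence (or branched) cover —
  `CoverDivisorNonVanishing` is the typed necessary condition / transfer of the card.
* `TwinVanishing` (card `packet-twin-periods`, informal companion): not typed (no automorphic
  vocabulary); see the card.
-/

noncomputable section

namespace Summit.HodgeConjecture.HodgeConjecture.Cruxes.IsotypicMiddleClassesAlgebraic.IdeatorFive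

set_option linter.dupNamespace false

open CategoryTheory MonoidalCategory
open Literature.AlgebraicGeometry Literature.AlgebraicGeometry.HodgeTheory
open Literature.AlgebraicGeometry.ShimuraVarieties Literature.AlgebraicTopology.SingularHomology
open Summit.HodgeConjecture.HodgeConjecture.Theses

/-- degree bookkeeping: `e ∪ d`, `e ∈ H^{2(m+1)}`, `d ∈ H²`. -/
theorem deg_e_d (m : ℕ) : 2 * (m + 1) + 2 * 1 = 2 * (m + 2) := by ring

/-- degree bookkeeping: `(e ∪ d) ∪ a`, `a ∈ H^{2m}`, target written as in the route's TW-orthogonality. -/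
theorem deg_ed_a (m : ℕ) : 2 * (m + 2) + 2 * m = 2 * ((m + 1) + (m + 1)) := by ring

/-- **DIVISORIAL INVISIBILITY** (first lemma of card `noncongruence-divisor-ring`).
For `X` carrying a `UnitaryBallQuotientDatum (2(m+1))` (`n = m+1 ∈ {2,3}`), a rational Hodge
`(n,n)`-class `e` which is cup-orthogonal to every product `a ∪ d` (`a` rational Hodge `(m,m)`,
`d ∈ N¹ = algebraicClasses X 1`) — in particular every `e ⊥ TW(D)` as in `OrthogonalSplit` /
`OrthogonalEnveloped` — satisfies `e ∪ d = 0` in `H^{2n+2}(X(ℂ); ℂ)` for EVERY divisor class `d`.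
Hypotheses (all classical, stated as data so that the lemma elaborates over the tree today):
(PD) Poincaré duality `H^{2n+2} × H^{2n-2} → H^{4n}` is non-degenerate in the first variable;
(C62) every `b ∈ H^{2m}` pairs with `(m+2,m+2)`-classes like an element of the `ℂ`-span of the
rational Hodge `(m,m)`-classes (BMM arXiv:1306.1515 Cor. 62: `H^{n-1,n-1}(X)` is defined over `ℚ`
for `n ≤ 3`, plus `H^{p,q} ∪ H^{m+2,m+2} = 0` in top degree unless `(p,q) = (m,m)`);
(TY) Hodge types add under `∪` and algebraic divisor classes are of type `(1,1)`;
(AS) `(e ∪ d) ∪ a = e ∪ (a ∪ d)` (associativity + even-degree commutativity of `∪`). -/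
def DivisorialInvisibility (m : ℕ) : Prop :=
  ∀ (X : Motives.SchemeOver ℂ) (_D : UnitaryBallQuotientDatum (2 * (m + 1)) X),
    (∀ z : complexBetti X (2 * (m + 2)),
        (∀ b : complexBetti X (2 * m), cupProduct (deg_ed_a m) z b = 0) → z = 0) →
    (∀ b : complexBetti X (2 * m), ∃ b' ∈ Submodule.span ℂ
        {a : complexBetti X (2 * m) | IsRationalClass a ∧ IsOfHodgeType (2 * (m + 1)) X (2 * m) m m a},
        ∀ z : complexBetti X (2 * (m + 2)),
          IsOfHodgeType (2 * (m + 1)) X (2 * (m + 2)) (m + 2) (m + 2) z →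
            cupProduct (deg_ed_a m) z b = cupProduct (deg_ed_a m) z b') →
    (∀ (e : complexBetti X (2 * (m + 1))) (d : complexBetti X (2 * 1)),
        IsOfHodgeType (2 * (m + 1)) X (2 * (m + 1)) (m + 1) (m + 1) e → d ∈ algebraicClasses X 1 →
          IsOfHodgeType (2 * (m + 1)) X (2 * (m + 2)) (m + 2) (m + 2) (cupProduct (deg_e_d m) e d)) →
    (∀ (e : complexBetti X (2 * (m + 1))) (d : complexBetti X (2 * 1)) (a : complexBetti X (2 * m)),
        cupProduct (deg_ed_a m) (cupProduct (deg_e_d m) e d) a =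
          cupProduct (two_mul_add_two_mul (m + 1) (m + 1)) e
            (cupProduct (two_mul_add_two_mul m 1) a d)) →
    ∀ e : complexBetti X (2 * (m + 1)), IsRationalClass e →
      IsOfHodgeType (2 * (m + 1)) X (2 * (m + 1)) (m + 1) (m + 1) e →
      (∀ a : complexBetti X (2 * m), IsRationalClass a →
          IsOfHodgeType (2 * (m + 1)) X (2 * m) m m a →
          ∀ d ∈ algebraicClasses X 1,
            cupProduct (two_mul_add_two_mul (m + 1) (m + 1)) e
              (cupProduct (two_mul_add_two_mul m 1) a d) = 0) →
      ∀ d ∈ algebraicClasses X 1, cupProduct (deg_e_d m) e d = 0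

/-- `DivisorialInvisibility m` holds (pure linear algebra over the four hypotheses). -/
theorem divisorialInvisibility_holds (m : ℕ) : DivisorialInvisibility m := by
  intro X _D hPD hC62 hTY hAS e _he hHe horth d hd
  apply hPD
  intro b
  obtain ⟨b', hb'mem, hb'⟩ := hC62 b
  rw [hb' _ (hTY e d hHe hd)]
  -- `z ∪ a = 0` for every generator `a`, hence on the span
  have key : ∀ a ∈ Submodule.span ℂ
      {a : complexBetti X (2 * m) | IsRationalClass a ∧ IsOfHodgeType (2 * (m + 1)) X (2 * m) m m a},
      cupProduct (deg_ed_a m) (cupProduct (deg_e_d m) e d) a = 0 := by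
    intro a ha
    induction ha using Submodule.span_induction with
    | mem a ha =>
        rw [hAS]
        exact horth a ha.1 ha.2 d hd
    | zero => simp
    | add a a' _ _ iha iha' => rw [map_add, iha, iha', add_zero]
    | smul t a _ iha => rw [map_smul, iha, smul_zero]
  exact key b' hb'mem

/-- **COVER–DIVISOR NON-VANISHING** (typed NECESSARY form of the card's transfer `C⁺`): for every
admissible `(μ, m, X, D, γ)` of the crux and every non-zero rational `P`-fixed class `c`, some
smooth projective `X'` of the same dimension with a morphism `f : X' ⟶ X` (the card: a finite
étale NON-congruence cover, or a cyclic cover branched along special divisors) carries a divisor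
class `d` with `f^*c ∪ d ≠ 0`. By `DivisorialInvisibility`, `X' = X` (and every congruence cover)
is excluded whenever `c ⊥ Hdg^{m,m}_ℚ·N¹`. The card's sufficient form `C⁺` (the `P`-projections of
`f_*` of degree-`n` divisor MONOMIALS span the fixed piece) implies the crux via the landed
`stub_corrActionAlgebraic` + `stub_inversion` / `complexGysin_mem_algebraicClasses`. -/
def CoverDivisorNonVanishing (m : ℕ) : Prop :=
  ∀ (μ : OrientationFamily), μ.HasPoincareDuality → ∀ (X : Motives.SchemeOver ℂ)
    (D : UnitaryBallQuotientDatum (2 * (m + 1)) X), 1 ≤ m → m ≤ 2 →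
    ∀ γ ∈ algebraicClasses (X ⊗ X) (2 * (m + 1)),
      let P : complexBetti X (2 * (m + 1)) → complexBetti X (2 * (m + 1)) := fun β =>
        complexGysin μ (Motives.IsSmoothProjective.tensor_holds D.isSmoothProjective D.isSmoothProjective)
          D.isSmoothProjective (CartesianMonoidalCategory.fst X X)
          (show 2 * (m + 1) + 2 * (2 * (m + 1)) + 2 * (2 * (m + 1)) =
            2 * (m + 1) + 2 * (2 * (m + 1) + 2 * (m + 1)) by ring)
          (cupProduct (rfl : 2 * (m + 1) + 2 * (2 * (m + 1)) = 2 * (m + 1) + 2 * (2 * (m + 1)))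
            (complexBetti.map (CartesianMonoidalCategory.snd X X) (2 * (m + 1)) β) γ);
      (∀ β, IsRationalClass β → IsRationalClass (P β)) →
      (∀ β, IsOfHodgeType (2 * (m + 1)) X (2 * (m + 1)) (m + 1) (m + 1) (P β)) →
        ∀ c, IsRationalClass c → P c = c → c ≠ 0 →
          ∃ (X' : Motives.SchemeOver ℂ) (_ : Motives.IsSmoothProjective (2 * (m + 1)) X')
            (f : X' ⟶ X), ∃ d ∈ algebraicClasses X' 1,
              cupProduct (deg_e_d m) (complexBetti.map f (2 * (m + 1)) c) d ≠ 0

end Summit.HodgeConjecture.HodgeConjecture.Cruxes.IsotypicMiddleClassesAlgebraic.IdeatorFive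

end
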